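import Mathlib
import HarnessLib
import Literature.MathematicalPhysics.StatisticalMechanics.RenormalisationMapCounting

/-!
# Smallness bookkeeping for the remainder of the renormalisation map ([ABKM19] Lemma 9.6, proof)

The Lipschitz estimate of `S_k` (the crux line's `IsRGStepQ.lipschitz`, CH12-PLAN §5 (e2)) bounds the
four remainder sums of `GradientRG.nextKStep_sub_opC_eq` (RenormalisationMapRemainder) term by term
with the explicit constants of `GradientRG.tayNormLE_subsum_reblockTerm_sub_abkm`
(RenormalisationMapLipschitzSubABKM).  A term indexed by `(X, X₁, Y)` — `π(X) = U`, `X₁ ∈ 𝓟_k(X)`,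
`Y ∈ 𝓟_k(X ∖ X₁)` — carries the smallness `θ^{|X₁|_k} b^{|X∖X₁∖Y|_k} C^{|𝓒(Y)|} A^{−|Y|_k}` (one factor
`8e^{1/4}‖H̃‖` per block of `X₁`, one factor `8e^{1/4}‖H‖` per block of `X ∖ X₁ ∖ Y`, one factor
`‖K‖ A^{−|Z|_k}` per component `Z` of `Y`), of total degree `D = |X ∖ Y|_k + |𝓒(Y)| ≥ 2`; its
Lipschitz variation keeps `D − 1` small factors.  This file is the elementary bookkeeping that turns
such bounds into `E · c(d,L)^{|U|_{k+1}} · A^{−η(d)|U|_{k+1}}`: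

* `add_pow_sub_pow_le`, `add_pow_succ_sub_pow_succ_le`, `prod_const_add_sub_prod_const_le` —
  `(x+δ)^m − x^m ≤ δ(1+x+δ)^m`, `≤ δ·m·(x+δ)^{m−1}` (differences of the block-product constants);
* `smallness_lipschitz`, `smallness_zeroth` — if `ω A² ≤ 1` and `n + m ≥ 2` then
  `ω^{n+m−1} A^{−y} ≤ ω A⁴ · A^{−(2n+y+m)}` and `ω^{n+m} A^{−y} ≤ ω² A⁴ · A^{−(2n+y+m)}`
  (with `n = |X∖Y|_k`, `y = |Y|_k`, `m = |𝓒(Y)|` the right-hand exponent is the one of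
  `gain_reblock_le_exponent` at `X₁ := X ∖ Y`);
* `sum_polys_sdiff_eq`, `sum_polys_sum_polys_sdiff_comm`, `sum_polys_sum_polys_sdiff_le` — reindexing
  `Y ↦ X ∖ Y` on `𝓟_k(X)`, the symmetry of the double sum over disjoint sub-polymers, and
  `Σ_{X₁∈𝓟(X)} Σ_{Y∈𝓟(X∖X₁)} f(Y) ≤ 2^{|X|_k} Σ_{Y∈𝓟(X)} f(Y)`;
* `card_blocks_le_of_reblock_eq` — `|X|_k ≤ c(d)|U|_k` for `π(X) = U` (`X ⊆ U⁺`), and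
  `sum_reblock_pairs_weighted_le(_pow)` — `sum_reblock_pairs_le(_pow)` with a weight `c^{|X|_k}`;
* **`sum_reblock_triples_le`**, **`sum_reblock_triples_le_pow`** — the master bound: if every term
  obeys `F(X,X₁,Y) ≤ c^{|X|_k} · E · A^{−(2|X∖Y|_k + |Y|_k + |𝓒(Y)|)}` on sub-families of the index set,
  then `Σ F ≤ E · (2c)^{c(d)|U|_k} 4^{c(d)|U|_k} A^{−η|U|_{k+1}}` (torus version: gain discharged,
  `|U|_k = L^d|U|_{k+1}`);
* **`sum_reblock_large_le`**, `sum_reblock_large_le_pow` — the same for sums over connected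
  non-block `X` with `π(X) = U` and terms `≤ c^{|X|_k} · E · A^{−|X|_k}` (the `largePartIndex` pieces).

Everything is proved; no named fact.  Pure combinatorics and real arithmetic (no functionals).

## References
* S. Adams, S. Buchholz, R. Kotecký, S. Müller, *Cauchy–Born rule from microscopic models with
  non-convex potentials*, arXiv:1910.13564, proof of Lemma 9.6 ((9.36)–(9.39)), Theorem 6.8
  [AdamsBuchholzKoteckyMuller2019].
* D. C. Brydges, *Lectures on the renormalisation group*, IAS/Park City Math. Ser. 16 (2009),
  Lemma 6.15 [Brydges2009].
-/

noncomputable section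

namespace Literature.MathematicalPhysics.StatisticalMechanics.TorusPolymer

open scoped BigOperators Classical
open Finset
open Literature.Barriers.CriticalPhenomena.LongRangePhi4.Polymer (IsConn components)

variable {d M : ℕ} [NeZero M]

/-! ## Differences of powers -/

omit [NeZero M] in
/-- `(x+δ)^m − x^m ≤ δ (1 + x + δ)^m` for `x, δ ≥ 0`.
[cite: AdamsBuchholzKoteckyMuller2019, proof of Lemma 9.6 (first order)] -/
theorem add_pow_sub_pow_le {x δ : ℝ} (hx : 0 ≤ x) (hδ : 0 ≤ δ) (m : ℕ) :
    (x + δ) ^ m - x ^ m ≤ δ * (1 + x + δ) ^ m := by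
  induction m with
  | zero => simpa using hδ
  | succ m ih =>
    have h1 : (x + δ) ^ (m + 1) - x ^ (m + 1) = (x + δ) * ((x + δ) ^ m - x ^ m) + δ * x ^ m := by ring
    have h2 : x ^ m ≤ (1 + x + δ) ^ m := pow_le_pow_left₀ hx (by linarith) m
    have hxδ : 0 ≤ x + δ := by positivity
    rw [h1]
    calc (x + δ) * ((x + δ) ^ m - x ^ m) + δ * x ^ m
        ≤ (x + δ) * (δ * (1 + x + δ) ^ m) + δ * (1 + x + δ) ^ m := by gcongr
      _ = δ * (1 + x + δ) ^ (m + 1) := by ring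

omit [NeZero M] in
/-- `(x+δ)^{m+1} − x^{m+1} ≤ δ (m+1) (x+δ)^m` for `x, δ ≥ 0` (mean-value form).
[cite: AdamsBuchholzKoteckyMuller2019, proof of Lemma 9.6 (first order)] -/
theorem add_pow_succ_sub_pow_succ_le {x δ : ℝ} (hx : 0 ≤ x) (hδ : 0 ≤ δ) (m : ℕ) :
    (x + δ) ^ (m + 1) - x ^ (m + 1) ≤ δ * (m + 1 : ℕ) * (x + δ) ^ m := by
  induction m with
  | zero => simp
  | succ m ih =>
    have h1 : (x + δ) ^ (m + 1 + 1) - x ^ (m + 1 + 1) =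
        (x + δ) * ((x + δ) ^ (m + 1) - x ^ (m + 1)) + δ * x ^ (m + 1) := by ring
    have h2 : x ^ (m + 1) ≤ (x + δ) ^ (m + 1) := pow_le_pow_left₀ hx (by linarith) _
    have hxδ : 0 ≤ x + δ := by positivity
    rw [h1]
    calc (x + δ) * ((x + δ) ^ (m + 1) - x ^ (m + 1)) + δ * x ^ (m + 1)
        ≤ (x + δ) * (δ * (m + 1 : ℕ) * (x + δ) ^ m) + δ * (x + δ) ^ (m + 1) := by gcongr
      _ = δ * (m + 1 + 1 : ℕ) * (x + δ) ^ (m + 1) := by push_cast; ring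

omit [NeZero M] in
/-- Product form: `∏_{i∈S}(x+δ) − ∏_{i∈S} x ≤ δ |S| (x+δ)^{|S|−1}` for `x, δ ≥ 0` (the block-product
constants `∏_{B∈𝓑_k(Z)} a` of the reblocked-term bounds).
[cite: AdamsBuchholzKoteckyMuller2019, proof of Lemma 9.6 (first order)] -/
theorem prod_const_add_sub_prod_const_le {ι : Type*} (S : Finset ι) {x δ : ℝ} (hx : 0 ≤ x) (hδ : 0 ≤ δ) :
    (∏ _i ∈ S, (x + δ)) - ∏ _i ∈ S, x ≤ δ * S.card * (x + δ) ^ (S.card - 1) := by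
  rw [prod_const, prod_const]
  rcases Nat.eq_zero_or_pos S.card with h0 | hpos
  · rw [h0]; simp
  · obtain ⟨m, hm⟩ : ∃ m, S.card = m + 1 := ⟨S.card - 1, by omega⟩
    rw [hm, Nat.add_sub_cancel]
    exact add_pow_succ_sub_pow_succ_le hx hδ m

omit [NeZero M] in
/-- Product form, crude: `∏_{i∈S}(x+δ) − ∏_{i∈S} x ≤ δ (1+x+δ)^{|S|}`.
[cite: AdamsBuchholzKoteckyMuller2019, proof of Lemma 9.6 (first order)] -/
theorem prod_const_add_sub_prod_const_le' {ι : Type*} (S : Finset ι) {x δ : ℝ} (hx : 0 ≤ x) (hδ : 0 ≤ δ) :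
    (∏ _i ∈ S, (x + δ)) - ∏ _i ∈ S, x ≤ δ * (1 + x + δ) ^ S.card := by
  rw [prod_const, prod_const]
  exact add_pow_sub_pow_le hx hδ S.card

/-! ## Per-term smallness: trading small factors for powers of `A` -/

omit [NeZero M] in
/-- If `ω A² ≤ 1` then `ω^e ≤ A^{−2e}`. [cite: AdamsBuchholzKoteckyMuller2019, proof of Lemma 9.6 (9.36)] -/
theorem pow_le_inv_pow_of_mul_sq_le {A ω : ℝ} (hA : 1 ≤ A) (hω : 0 ≤ ω) (hωA : ω * A ^ 2 ≤ 1) (e : ℕ) :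
    ω ^ e ≤ (A ^ (2 * e))⁻¹ := by
  have hA0 : 0 < A := by linarith
  have h1 : ω ≤ (A ^ 2)⁻¹ := by
    rw [← one_div]; exact (le_div_iff₀ (by positivity)).2 hωA
  calc ω ^ e ≤ ((A ^ 2)⁻¹) ^ e := pow_le_pow_left₀ hω h1 e
    _ = (A ^ (2 * e))⁻¹ := by rw [inv_pow, ← pow_mul]

omit [NeZero M] in
/-- **Lipschitz smallness of one term.**  If `ω A² ≤ 1`, `A ≥ 1` and the degree `n + m = e + 2 ≥ 2`,
then `ω^{e+1} A^{−y} ≤ ω A⁴ · A^{−(2n+y+m)}`: a Lipschitz term (one small factor replaced by a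
difference, `e + 1 = D − 1` small factors left) is `ω A⁴` times the summand of the animal sum with
exponent `2|X∖Y|_k + |Y|_k + |𝓒(Y)|` (`n = |X∖Y|_k`, `y = |Y|_k`, `m = |𝓒(Y)|`).
[cite: AdamsBuchholzKoteckyMuller2019, proof of Lemma 9.6 (9.36)–(9.39)] -/
theorem smallness_lipschitz {A ω : ℝ} (hA : 1 ≤ A) (hω : 0 ≤ ω) (hωA : ω * A ^ 2 ≤ 1)
    {n m e : ℕ} (hD : n + m = e + 2) (y : ℕ) :
    ω ^ (e + 1) * (A ^ y)⁻¹ ≤ ω * A ^ 4 * (A ^ (2 * n + y + m))⁻¹ := by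
  have hA0 : 0 < A := by linarith
  have h1 := pow_le_inv_pow_of_mul_sq_le hA hω hωA e
  have h2 : (A ^ (2 * e))⁻¹ * (A ^ y)⁻¹ ≤ A ^ 4 * (A ^ (2 * n + y + m))⁻¹ := by
    rw [← mul_inv, ← pow_add]
    have hle : A ^ (2 * n + y + m) ≤ A ^ 4 * A ^ (2 * e + y) := by
      rw [← pow_add]; exact pow_le_pow_right₀ hA (by omega)
    calc (A ^ (2 * e + y))⁻¹ = A ^ 4 * (A ^ 4 * A ^ (2 * e + y))⁻¹ := by
          rw [mul_inv, ← mul_assoc, mul_inv_cancel₀ (by positivity), one_mul]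
      _ ≤ A ^ 4 * (A ^ (2 * n + y + m))⁻¹ := by
          refine mul_le_mul_of_nonneg_left (inv_anti₀ (by positivity) hle) (by positivity)
  calc ω ^ (e + 1) * (A ^ y)⁻¹ = ω * (ω ^ e * (A ^ y)⁻¹) := by ring
    _ ≤ ω * ((A ^ (2 * e))⁻¹ * (A ^ y)⁻¹) := by
        refine mul_le_mul_of_nonneg_left ?_ hω
        exact mul_le_mul_of_nonneg_right h1 (by positivity)
    _ ≤ ω * (A ^ 4 * (A ^ (2 * n + y + m))⁻¹) := mul_le_mul_of_nonneg_left h2 hω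
    _ = ω * A ^ 4 * (A ^ (2 * n + y + m))⁻¹ := by ring

omit [NeZero M] in
/-- **Zeroth-order smallness of one term**: under the same hypotheses
`ω^{e+2} A^{−y} ≤ ω² A⁴ · A^{−(2n+y+m)}` (all `D = n + m` small factors kept).
[cite: AdamsBuchholzKoteckyMuller2019, proof of Lemma 9.6 (9.36)–(9.39)] -/
theorem smallness_zeroth {A ω : ℝ} (hA : 1 ≤ A) (hω : 0 ≤ ω) (hωA : ω * A ^ 2 ≤ 1)
    {n m e : ℕ} (hD : n + m = e + 2) (y : ℕ) :
    ω ^ (e + 2) * (A ^ y)⁻¹ ≤ ω ^ 2 * A ^ 4 * (A ^ (2 * n + y + m))⁻¹ := by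
  have h := smallness_lipschitz hA hω hωA hD y
  calc ω ^ (e + 2) * (A ^ y)⁻¹ = ω * (ω ^ (e + 1) * (A ^ y)⁻¹) := by ring
    _ ≤ ω * (ω * A ^ 4 * (A ^ (2 * n + y + m))⁻¹) := mul_le_mul_of_nonneg_left h hω
    _ = ω ^ 2 * A ^ 4 * (A ^ (2 * n + y + m))⁻¹ := by ring

/-! ## Reindexing the sums over sub-polymers -/

/-- The involution `Y ↦ X ∖ Y` of `𝓟_k(X)`: `Σ_{Y∈𝓟(X)} g(X∖Y, Y) = Σ_{X₁∈𝓟(X)} g(X₁, X∖X₁)` for a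
`k`-polymer `X`. [cite: AdamsBuchholzKoteckyMuller2019, proof of Lemma 9.6 ((9.36): X₂ = X ∖ X₁)] -/
theorem sum_polys_sdiff_eq {s : ℕ} {X : Finset (Fin d → ZMod M)} (hX : IsPolymer s X) {β : Type*}
    [AddCommMonoid β] (g : Finset (Fin d → ZMod M) → Finset (Fin d → ZMod M) → β) :
    ∑ Y ∈ polys s X, g (X \ Y) Y = ∑ X₁ ∈ polys s X, g X₁ (X \ X₁) := by
  refine sum_nbij' (fun Y => X \ Y) (fun X₁ => X \ X₁) ?_ ?_ ?_ ?_ ?_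
  · intro Y hY; exact mem_polys.2 ⟨sdiff_subset, hX.sdiff (mem_polys.1 hY).2⟩
  · intro X₁ hX₁; exact mem_polys.2 ⟨sdiff_subset, hX.sdiff (mem_polys.1 hX₁).2⟩
  · intro Y hY; exact Finset.sdiff_sdiff_eq_self (mem_polys.1 hY).1
  · intro X₁ hX₁; exact Finset.sdiff_sdiff_eq_self (mem_polys.1 hX₁).1
  · intro Y hY; rw [Finset.sdiff_sdiff_eq_self (mem_polys.1 hY).1]

/-- Symmetry of the double sum over pairs of disjoint sub-polymers:
`Σ_{X₁∈𝓟(X)} Σ_{Y∈𝓟(X∖X₁)} g(X₁,Y) = Σ_{Y∈𝓟(X)} Σ_{X₁∈𝓟(X∖Y)} g(X₁,Y)`.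
[cite: AdamsBuchholzKoteckyMuller2019, proof of Lemma 9.6 (9.36)] -/
theorem sum_polys_sum_polys_sdiff_comm {s : ℕ} (X : Finset (Fin d → ZMod M)) {β : Type*}
    [AddCommMonoid β] (g : Finset (Fin d → ZMod M) → Finset (Fin d → ZMod M) → β) :
    ∑ X₁ ∈ polys s X, ∑ Y ∈ polys s (X \ X₁), g X₁ Y =
      ∑ Y ∈ polys s X, ∑ X₁ ∈ polys s (X \ Y), g X₁ Y := by
  refine sum_comm' fun X₁ Y => ?_
  simp only [mem_polys, subset_sdiff]
  constructor
  · rintro ⟨⟨h1, h2⟩, ⟨h3, h4⟩, h5⟩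
    exact ⟨⟨⟨h1, h4.symm⟩, h2⟩, h3, h5⟩
  · rintro ⟨⟨⟨h1, h4⟩, h2⟩, h3, h5⟩
    exact ⟨⟨h1, h2⟩, ⟨h3, h4.symm⟩, h5⟩

/-- **Counting the triples**: `Σ_{X₁∈𝓟_k(X)} Σ_{Y∈𝓟_k(X∖X₁)} f(Y) ≤ 2^{|X|_k} Σ_{Y∈𝓟_k(X)} f(Y)` for
`f ≥ 0` (given `Y`, the polymer `X₁ ⊆ X ∖ Y` has at most `2^{|X∖Y|_k}` values).
[cite: AdamsBuchholzKoteckyMuller2019, proof of Lemma 9.6 ("3^{|U*|_k} possibilities")] -/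
theorem sum_polys_sum_polys_sdiff_le {s : ℕ} (X : Finset (Fin d → ZMod M))
    {f : Finset (Fin d → ZMod M) → ℝ} (hf : ∀ Y ∈ polys s X, 0 ≤ f Y) :
    ∑ X₁ ∈ polys s X, ∑ Y ∈ polys s (X \ X₁), f Y ≤ 2 ^ (blocks s X).card * ∑ Y ∈ polys s X, f Y := by
  rw [sum_polys_sum_polys_sdiff_comm X (fun _ Y => f Y), mul_sum]
  refine sum_le_sum fun Y hY => ?_
  rw [sum_const, nsmul_eq_mul]
  refine mul_le_mul_of_nonneg_right ?_ (hf Y hY)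
  have h1 : (polys s (X \ Y)).card ≤ 2 ^ (blocks s X).card :=
    (card_polys_le_two_pow s _).trans
      (Nat.pow_le_pow_right (by norm_num) (card_le_card (blocks_mono s sdiff_subset)))
  exact_mod_cast h1

/-! ## The π-preimages of `U`: block count and weighted animal sums -/

/-- **`|X|_k ≤ c(d)|U|_k` for `π(X) = U`**, `c(d) = (2^{d+1}+2)^d` (`X ⊆ U + [−(2^d−1)L^k, (2^d−1)L^k]^d`).
[cite: AdamsBuchholzKoteckyMuller2019, proof of Lemma 9.6 ((9.33): |U*|_k ≤ 2|U|_k)] -/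
theorem card_blocks_le_of_reblock_eq {s L t : ℕ} (hM : M = L * s * t) (hs : Odd s) (hL : Odd L)
    (ht : Odd t) {X U : Finset (Fin d → ZMod M)} (hXU : reblock s (L * s) X = U) :
    (blocks s X).card ≤ (2 ^ (d + 1) + 2) ^ d * (blocks s U).card := by
  have hMst : M = s * (L * t) := by rw [hM]; ring
  have hXsub : X ⊆ thicken ((2 ^ d - 1) * s) U := by
    rw [← hXU]; exact subset_thicken_reblock hMst hs (hL.mul ht) hL X
  exact (card_le_card (blocks_mono s hXsub)).trans (card_blocks_thicken_le hMst hs (hL.mul ht) U)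

/-- **Weighted animal sum**: `sum_reblock_pairs_le` with a weight `c^{|X|_k}`, `c ≥ 1`:
`Σ_{π(X)=U} Σ_{X₁∈𝓟_k(X)} c^{|X|_k} A^{−(2|X₁|_k+|X∖X₁|_k+|𝓒(X∖X₁)|)} ≤ c^{c(d)|U|_k} 4^{c(d)|U|_k} A^{−η|U|_{k+1}}`.
[cite: AdamsBuchholzKoteckyMuller2019, Lemma 9.6 (proof, (9.36)–(9.39))] -/
theorem sum_reblock_pairs_weighted_le {s L t : ℕ} (hM : M = L * s * t) (hs : Odd s) (hL : Odd L)
    (ht : Odd t) {A η c : ℝ} (hA : 1 ≤ A) (hη0 : 0 ≤ η) (hη2 : η ≤ 2) (hc : 1 ≤ c)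
    (hgain : ∀ X : Finset (Fin d → ZMod M), IsPolymer s X → IsConn X → 2 ^ d < (blocks s X).card →
      η * ((blocks (L * s) (closure (L * s) X)).card : ℝ) ≤ (blocks s X).card)
    (U : Finset (Fin d → ZMod M)) :
    ∑ X ∈ (polys s univ).filter (fun X => reblock s (L * s) X = U), ∑ X₁ ∈ polys s X,
        c ^ (blocks s X).card *
          (A ^ (2 * (blocks s X₁).card + (blocks s (X \ X₁)).card + (components (X \ X₁)).card))⁻¹ ≤
      c ^ ((2 ^ (d + 1) + 2) ^ d * (blocks s U).card) *
        ((4 : ℝ) ^ ((2 ^ (d + 1) + 2) ^ d * (blocks s U).card) * A ^ (-(η * (blocks (L * s) U).card) : ℝ)) := by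
  have hA0 : 0 < A := by linarith
  set n := (2 ^ (d + 1) + 2) ^ d * (blocks s U).card with hn
  set T := (polys s univ).filter (fun X => reblock s (L * s) X = U) with hT
  have hterm : ∀ X ∈ T, ∑ X₁ ∈ polys s X, c ^ (blocks s X).card *
      (A ^ (2 * (blocks s X₁).card + (blocks s (X \ X₁)).card + (components (X \ X₁)).card))⁻¹ ≤
      c ^ n * ∑ X₁ ∈ polys s X,
        (A ^ (2 * (blocks s X₁).card + (blocks s (X \ X₁)).card + (components (X \ X₁)).card))⁻¹ := by
    intro X hX
    rw [← mul_sum]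
    refine mul_le_mul_of_nonneg_right ?_ (sum_nonneg fun _ _ => by positivity)
    exact pow_le_pow_right₀ hc (card_blocks_le_of_reblock_eq hM hs hL ht (mem_filter.1 hX).2)
  refine (sum_le_sum hterm).trans ?_
  rw [← mul_sum]
  exact mul_le_mul_of_nonneg_left (sum_reblock_pairs_le hM hs hL ht hA hη0 hη2 hgain U) (by positivity)

/-- **The master bound for triple sums** (sub-families allowed).  On the torus `M = L·s·t` (odd sides),
`A ≥ 1`, `0 ≤ η ≤ 2` not exceeding the gain, `c ≥ 1`, `E ≥ 0`: if `𝓧' ⊆ {π(X) = U}`, `𝓨(X) ⊆ 𝓟_k(X)`,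
`𝓩(X,X₁) ⊆ 𝓟_k(X∖X₁)` and every term obeys `F(X,X₁,Y) ≤ c^{|X|_k} · E · A^{−(2|X∖Y|_k + |Y|_k + |𝓒(Y)|)}`,
then `Σ_{X∈𝓧'} Σ_{X₁∈𝓨(X)} Σ_{Y∈𝓩(X,X₁)} F ≤ E · (2c)^{c(d)|U|_k} 4^{c(d)|U|_k} A^{−η|U|_{k+1}}`.
[cite: AdamsBuchholzKoteckyMuller2019, Lemma 9.6 (proof, (9.36)–(9.39))] -/
theorem sum_reblock_triples_le {s L t : ℕ} (hM : M = L * s * t) (hs : Odd s) (hL : Odd L) (ht : Odd t)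
    {A η c E : ℝ} (hA : 1 ≤ A) (hη0 : 0 ≤ η) (hη2 : η ≤ 2) (hc : 1 ≤ c) (hE : 0 ≤ E)
    (hgain : ∀ X : Finset (Fin d → ZMod M), IsPolymer s X → IsConn X → 2 ^ d < (blocks s X).card →
      η * ((blocks (L * s) (closure (L * s) X)).card : ℝ) ≤ (blocks s X).card)
    {U : Finset (Fin d → ZMod M)} {𝓧' : Finset (Finset (Fin d → ZMod M))}
    (h𝓧' : 𝓧' ⊆ (polys s univ).filter (fun X => reblock s (L * s) X = U))
    {𝓨 : Finset (Fin d → ZMod M) → Finset (Finset (Fin d → ZMod M))} (h𝓨 : ∀ X ∈ 𝓧', 𝓨 X ⊆ polys s X)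
    {𝓩 : Finset (Fin d → ZMod M) → Finset (Fin d → ZMod M) → Finset (Finset (Fin d → ZMod M))}
    (h𝓩 : ∀ X ∈ 𝓧', ∀ X₁ ∈ 𝓨 X, 𝓩 X X₁ ⊆ polys s (X \ X₁))
    {F : Finset (Fin d → ZMod M) → Finset (Fin d → ZMod M) → Finset (Fin d → ZMod M) → ℝ}
    (hF : ∀ X ∈ 𝓧', ∀ X₁ ∈ 𝓨 X, ∀ Y ∈ 𝓩 X X₁, F X X₁ Y ≤ c ^ (blocks s X).card * E *
      (A ^ (2 * (blocks s (X \ Y)).card + (blocks s Y).card + (components Y).card))⁻¹) :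
    ∑ X ∈ 𝓧', ∑ X₁ ∈ 𝓨 X, ∑ Y ∈ 𝓩 X X₁, F X X₁ Y ≤
      E * ((2 * c) ^ ((2 ^ (d + 1) + 2) ^ d * (blocks s U).card) *
        ((4 : ℝ) ^ ((2 ^ (d + 1) + 2) ^ d * (blocks s U).card) * A ^ (-(η * (blocks (L * s) U).card) : ℝ))) := by
  have hA0 : 0 < A := by linarith
  have hc0 : 0 ≤ c := by linarith
  set T := (polys s univ).filter (fun X => reblock s (L * s) X = U) with hT
  -- the majorant, as a function of `(X, Y)`
  set G : Finset (Fin d → ZMod M) → Finset (Fin d → ZMod M) → ℝ := fun X Y =>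
    c ^ (blocks s X).card * E *
      (A ^ (2 * (blocks s (X \ Y)).card + (blocks s Y).card + (components Y).card))⁻¹ with hG
  have hG0 : ∀ X Y, 0 ≤ G X Y := fun X Y => by rw [hG]; positivity
  -- Step 1: pass to the majorant on the full inner families
  have h1 : ∀ X ∈ 𝓧', ∑ X₁ ∈ 𝓨 X, ∑ Y ∈ 𝓩 X X₁, F X X₁ Y ≤
      ∑ X₁ ∈ polys s X, ∑ Y ∈ polys s (X \ X₁), G X Y := by
    intro X hX
    calc ∑ X₁ ∈ 𝓨 X, ∑ Y ∈ 𝓩 X X₁, F X X₁ Y ≤ ∑ X₁ ∈ 𝓨 X, ∑ Y ∈ 𝓩 X X₁, G X Y :=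
          sum_le_sum fun X₁ hX₁ => sum_le_sum fun Y hY => hF X hX X₁ hX₁ Y hY
      _ ≤ ∑ X₁ ∈ 𝓨 X, ∑ Y ∈ polys s (X \ X₁), G X Y :=
          sum_le_sum fun X₁ hX₁ => sum_le_sum_of_subset_of_nonneg (h𝓩 X hX X₁ hX₁) fun Y _ _ => hG0 X Y
      _ ≤ ∑ X₁ ∈ polys s X, ∑ Y ∈ polys s (X \ X₁), G X Y :=
          sum_le_sum_of_subset_of_nonneg (h𝓨 X hX) fun X₁ _ _ => sum_nonneg fun Y _ => hG0 X Y
  -- Step 2: count the `X₁` and reindex `Y ↦ X ∖ Y`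
  have h2 : ∀ X ∈ 𝓧', ∑ X₁ ∈ polys s X, ∑ Y ∈ polys s (X \ X₁), G X Y ≤
      E * ∑ X₁ ∈ polys s X, (2 * c) ^ (blocks s X).card *
        (A ^ (2 * (blocks s X₁).card + (blocks s (X \ X₁)).card + (components (X \ X₁)).card))⁻¹ := by
    intro X hX
    have hXp : IsPolymer s X := (mem_polys.1 (mem_filter.1 (h𝓧' hX)).1).2
    refine (sum_polys_sum_polys_sdiff_le X (fun Y _ => hG0 X Y)).trans (le_of_eq ?_)
    have hre := sum_polys_sdiff_eq hXp (fun X₁ Y => c ^ (blocks s X).card * E *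
      (A ^ (2 * (blocks s X₁).card + (blocks s Y).card + (components Y).card))⁻¹)
    simp only [hG]
    rw [hre, mul_sum, mul_sum]
    refine sum_congr rfl fun X₁ _ => ?_
    rw [mul_pow]
    ring
  -- Step 3: the weighted animal sum
  have h3 : ∑ X ∈ 𝓧', E * ∑ X₁ ∈ polys s X, (2 * c) ^ (blocks s X).card *
        (A ^ (2 * (blocks s X₁).card + (blocks s (X \ X₁)).card + (components (X \ X₁)).card))⁻¹ ≤
      ∑ X ∈ T, E * ∑ X₁ ∈ polys s X, (2 * c) ^ (blocks s X).card *
        (A ^ (2 * (blocks s X₁).card + (blocks s (X \ X₁)).card + (components (X \ X₁)).card))⁻¹ :=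
    sum_le_sum_of_subset_of_nonneg h𝓧' fun X _ _ =>
      mul_nonneg hE (sum_nonneg fun _ _ => by positivity)
  have h2c : (1 : ℝ) ≤ 2 * c := by linarith
  calc ∑ X ∈ 𝓧', ∑ X₁ ∈ 𝓨 X, ∑ Y ∈ 𝓩 X X₁, F X X₁ Y
      ≤ ∑ X ∈ 𝓧', ∑ X₁ ∈ polys s X, ∑ Y ∈ polys s (X \ X₁), G X Y := sum_le_sum h1
    _ ≤ ∑ X ∈ 𝓧', E * ∑ X₁ ∈ polys s X, (2 * c) ^ (blocks s X).card *
        (A ^ (2 * (blocks s X₁).card + (blocks s (X \ X₁)).card + (components (X \ X₁)).card))⁻¹ :=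
        sum_le_sum h2
    _ ≤ ∑ X ∈ T, E * ∑ X₁ ∈ polys s X, (2 * c) ^ (blocks s X).card *
        (A ^ (2 * (blocks s X₁).card + (blocks s (X \ X₁)).card + (components (X \ X₁)).card))⁻¹ := h3
    _ = E * ∑ X ∈ T, ∑ X₁ ∈ polys s X, (2 * c) ^ (blocks s X).card *
        (A ^ (2 * (blocks s X₁).card + (blocks s (X \ X₁)).card + (components (X \ X₁)).card))⁻¹ := by
        rw [← mul_sum]
    _ ≤ _ := mul_le_mul_of_nonneg_left (sum_reblock_pairs_weighted_le hM hs hL ht hA hη0 hη2 h2c hgain U) hE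

/-- **The master bound for the large connected preimages** (the `largePartIndex` pieces of the
remainder): if `𝓧'' ⊆ {π(X) = U}` consists of connected polymers with at least two blocks and
`F(X) ≤ c^{|X|_k} · E · A^{−|X|_k}` on it, then `Σ_{X∈𝓧''} F ≤ E · c^{c(d)|U|_k} 2^{c(d)|U|_k} A^{−η|U|_{k+1}}`
(closure gain for connected non-block polymers, `gain_reblock_le_of_isConn`).
[cite: AdamsBuchholzKoteckyMuller2019, Lemma 9.6 (proof) / Lemma 10.2 (proof)] -/
theorem sum_reblock_large_le {s L t : ℕ} (hM : M = L * s * t) (hs : Odd s) (hL : Odd L) (ht : Odd t)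
    {A η c E : ℝ} (hA : 1 ≤ A) (hη2 : η ≤ 2) (hc : 1 ≤ c) (hE : 0 ≤ E)
    (hgain : ∀ X : Finset (Fin d → ZMod M), IsPolymer s X → IsConn X → 2 ^ d < (blocks s X).card →
      η * ((blocks (L * s) (closure (L * s) X)).card : ℝ) ≤ (blocks s X).card)
    {U : Finset (Fin d → ZMod M)} {𝓧'' : Finset (Finset (Fin d → ZMod M))}
    (h𝓧'' : 𝓧'' ⊆ (polys s univ).filter (fun X => reblock s (L * s) X = U))
    (hconn : ∀ X ∈ 𝓧'', IsConn X) (htwo : ∀ X ∈ 𝓧'', 2 ≤ (blocks s X).card)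
    {F : Finset (Fin d → ZMod M) → ℝ}
    (hF : ∀ X ∈ 𝓧'', F X ≤ c ^ (blocks s X).card * E * (A ^ (blocks s X).card)⁻¹) :
    ∑ X ∈ 𝓧'', F X ≤
      E * (c ^ ((2 ^ (d + 1) + 2) ^ d * (blocks s U).card) *
        ((2 : ℝ) ^ ((2 ^ (d + 1) + 2) ^ d * (blocks s U).card) * A ^ (-(η * (blocks (L * s) U).card) : ℝ))) := by
  have hA0 : 0 < A := by linarith
  set n := (2 ^ (d + 1) + 2) ^ d * (blocks s U).card with hn
  set T := (polys s univ).filter (fun X => reblock s (L * s) X = U) with hT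
  have hterm : ∀ X ∈ 𝓧'', F X ≤ E * (c ^ n * A ^ (-(η * (blocks (L * s) U).card) : ℝ)) := by
    intro X hX
    obtain ⟨hXp, hXU⟩ := mem_filter.1 (h𝓧'' hX)
    have hXP : IsPolymer s X := (mem_polys.1 hXp).2
    have hg := gain_reblock_le_of_isConn (L := L) hη2 hgain hXP (hconn X hX)
    rw [if_neg (by have := htwo X hX; omega), add_zero, hXU] at hg
    have h1 : (A ^ (blocks s X).card)⁻¹ ≤ A ^ (-(η * (blocks (L * s) U).card) : ℝ) :=
      inv_pow_le_rpow_of_gain hA hg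
    have h2 : c ^ (blocks s X).card ≤ c ^ n :=
      pow_le_pow_right₀ hc (card_blocks_le_of_reblock_eq hM hs hL ht hXU)
    calc F X ≤ c ^ (blocks s X).card * E * (A ^ (blocks s X).card)⁻¹ := hF X hX
      _ ≤ c ^ n * E * A ^ (-(η * (blocks (L * s) U).card) : ℝ) := by gcongr
      _ = E * (c ^ n * A ^ (-(η * (blocks (L * s) U).card) : ℝ)) := by ring
  refine (sum_le_card_nsmul _ _ _ hterm).trans ?_
  rw [nsmul_eq_mul]
  have hcard : (𝓧''.card : ℝ) ≤ (2 : ℝ) ^ n := by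
    have := (card_le_card h𝓧'').trans (card_filter_reblock_le hM hs hL ht U)
    exact_mod_cast this
  have hpos : 0 ≤ E * (c ^ n * A ^ (-(η * (blocks (L * s) U).card) : ℝ)) := by positivity
  calc (𝓧''.card : ℝ) * (E * (c ^ n * A ^ (-(η * (blocks (L * s) U).card) : ℝ)))
      ≤ (2 : ℝ) ^ n * (E * (c ^ n * A ^ (-(η * (blocks (L * s) U).card) : ℝ))) :=
        mul_le_mul_of_nonneg_right hcard hpos
    _ = E * (c ^ n * ((2 : ℝ) ^ n * A ^ (-(η * (blocks (L * s) U).card) : ℝ))) := by ring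

/-! ## On the renormalisation-group tori `M = L^N`: gain discharged -/

/-- Brydges' gain on the tori `M = L^N` at scale `k + 1 ≤ N` (from `closureGain`, `t = L^{N−k−1} ≠ 3`).
[cite: Brydges2009, Lemma 6.15; AdamsBuchholzKoteckyMuller2019, App. A Lemma A.1] -/
theorem gain_pow {L N k : ℕ} (hLodd : Odd L) (hL2 : 2 ^ d + 1 ≤ L) (hL4 : 4 ≤ L) (hM : M = L ^ N)
    (hkN : k + 1 ≤ N) :
    M = L * L ^ k * L ^ (N - k - 1) ∧ Odd (L ^ (N - k - 1)) ∧
      ∀ X : Finset (Fin d → ZMod M), IsPolymer (L ^ k) X → IsConn X → 2 ^ d < (blocks (L ^ k) X).card →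
        (1 + 1 / ((2 * (2 ^ d + 1) + 6 : ℝ) ^ d)) * ((blocks (L * L ^ k) (closure (L * L ^ k) X)).card : ℝ) ≤
          (blocks (L ^ k) X).card := by
  have hMeq : M = L * L ^ k * L ^ (N - k - 1) := by
    rw [hM, ← pow_succ', ← pow_add]; congr 1; omega
  have ht3 : L ^ (N - k - 1) ≠ 3 := by
    rcases Nat.eq_zero_or_pos (N - k - 1) with h0 | h0
    · rw [h0, pow_zero]; norm_num
    · intro h3
      have : L ≤ L ^ (N - k - 1) := Nat.le_self_pow (by omega) L
      omega
  exact ⟨hMeq, hLodd.pow, fun X hX hc hlarge => closureGain hMeq hLodd.pow hLodd hLodd.pow ht3 hL2 hX hc hlarge⟩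

omit [NeZero M] in
/-- `0 ≤ η(d) ≤ 2` for Brydges' `η(d) = 1 + (2(2^d+1)+6)^{−d}`. [cite: Brydges2009, Lemma 6.15] -/
theorem eta_bounds (d : ℕ) :
    0 ≤ 1 + 1 / ((2 * (2 ^ d + 1) + 6 : ℝ) ^ d) ∧ 1 + 1 / ((2 * (2 ^ d + 1) + 6 : ℝ) ^ d) ≤ 2 := by
  refine ⟨by positivity, ?_⟩
  have h1 : (1 : ℝ) ≤ ((2 * (2 ^ d + 1) + 6 : ℝ) ^ d) :=
    one_le_pow₀ (by have : (0 : ℝ) ≤ 2 ^ d := by positivity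
                    linarith)
  have : 1 / ((2 * (2 ^ d + 1) + 6 : ℝ) ^ d) ≤ 1 := by
    rw [div_le_one (by positivity)]; exact h1
  linarith

/-- **Master bound for triple sums on the tori `M = L^N`** (gain discharged, `|U|_k = L^d|U|_{k+1}`):
with `c(d) = (2^{d+1}+2)^d`, `η(d) = 1 + (2(2^d+1)+6)^{−d}` and `U` a `(k+1)`-polymer,
`Σ F ≤ E · ((2c)^{c(d)L^d} 4^{c(d)L^d})^{|U|_{k+1}} A^{−η(d)|U|_{k+1}}`.
[cite: AdamsBuchholzKoteckyMuller2019, Lemma 9.6 (proof, (9.39)); Brydges2009, Lemma 6.15] -/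
theorem sum_reblock_triples_le_pow {L N k : ℕ} (hLodd : Odd L) (hL2 : 2 ^ d + 1 ≤ L) (hL4 : 4 ≤ L)
    (hM : M = L ^ N) (hkN : k + 1 ≤ N) {A c E : ℝ} (hA : 1 ≤ A) (hc : 1 ≤ c) (hE : 0 ≤ E)
    {U : Finset (Fin d → ZMod M)} (hU : IsPolymer (L * L ^ k) U) {𝓧' : Finset (Finset (Fin d → ZMod M))}
    (h𝓧' : 𝓧' ⊆ (polys (L ^ k) univ).filter (fun X => reblock (L ^ k) (L * L ^ k) X = U))
    {𝓨 : Finset (Fin d → ZMod M) → Finset (Finset (Fin d → ZMod M))} (h𝓨 : ∀ X ∈ 𝓧', 𝓨 X ⊆ polys (L ^ k) X)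
    {𝓩 : Finset (Fin d → ZMod M) → Finset (Fin d → ZMod M) → Finset (Finset (Fin d → ZMod M))}
    (h𝓩 : ∀ X ∈ 𝓧', ∀ X₁ ∈ 𝓨 X, 𝓩 X X₁ ⊆ polys (L ^ k) (X \ X₁))
    {F : Finset (Fin d → ZMod M) → Finset (Fin d → ZMod M) → Finset (Fin d → ZMod M) → ℝ}
    (hF : ∀ X ∈ 𝓧', ∀ X₁ ∈ 𝓨 X, ∀ Y ∈ 𝓩 X X₁, F X X₁ Y ≤ c ^ (blocks (L ^ k) X).card * E *
      (A ^ (2 * (blocks (L ^ k) (X \ Y)).card + (blocks (L ^ k) Y).card + (components Y).card))⁻¹) :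
    ∑ X ∈ 𝓧', ∑ X₁ ∈ 𝓨 X, ∑ Y ∈ 𝓩 X X₁, F X X₁ Y ≤
      E * (((2 * c) ^ ((2 ^ (d + 1) + 2) ^ d * L ^ d) * (4 : ℝ) ^ ((2 ^ (d + 1) + 2) ^ d * L ^ d)) ^
          (blocks (L * L ^ k) U).card *
        A ^ (-((1 + 1 / ((2 * (2 ^ d + 1) + 6 : ℝ) ^ d)) * (blocks (L * L ^ k) U).card) : ℝ)) := by
  obtain ⟨hMeq, htodd, hgain⟩ := gain_pow (d := d) hLodd hL2 hL4 hM hkN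
  obtain ⟨hη0, hη2⟩ := eta_bounds d
  refine (sum_reblock_triples_le hMeq hLodd.pow hLodd htodd hA hη0 hη2 hc hE hgain h𝓧' h𝓨 h𝓩 hF).trans
    (le_of_eq ?_)
  rw [card_blocks_eq_mul hMeq hLodd.pow hLodd htodd hU, ← mul_assoc ((2 ^ (d + 1) + 2) ^ d), pow_mul, pow_mul,
    mul_pow]
  ring

/-- **Master bound for the large connected preimages on the tori `M = L^N`**:
`Σ_{X∈𝓧''} F ≤ E · (c^{c(d)L^d} 2^{c(d)L^d})^{|U|_{k+1}} A^{−η(d)|U|_{k+1}}`.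
[cite: AdamsBuchholzKoteckyMuller2019, Lemma 9.6 / Lemma 10.2 (proofs); Brydges2009, Lemma 6.15] -/
theorem sum_reblock_large_le_pow {L N k : ℕ} (hLodd : Odd L) (hL2 : 2 ^ d + 1 ≤ L) (hL4 : 4 ≤ L)
    (hM : M = L ^ N) (hkN : k + 1 ≤ N) {A c E : ℝ} (hA : 1 ≤ A) (hc : 1 ≤ c) (hE : 0 ≤ E)
    {U : Finset (Fin d → ZMod M)} (hU : IsPolymer (L * L ^ k) U) {𝓧'' : Finset (Finset (Fin d → ZMod M))}
    (h𝓧'' : 𝓧'' ⊆ (polys (L ^ k) univ).filter (fun X => reblock (L ^ k) (L * L ^ k) X = U))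
    (hconn : ∀ X ∈ 𝓧'', IsConn X) (htwo : ∀ X ∈ 𝓧'', 2 ≤ (blocks (L ^ k) X).card)
    {F : Finset (Fin d → ZMod M) → ℝ}
    (hF : ∀ X ∈ 𝓧'', F X ≤ c ^ (blocks (L ^ k) X).card * E * (A ^ (blocks (L ^ k) X).card)⁻¹) :
    ∑ X ∈ 𝓧'', F X ≤
      E * ((c ^ ((2 ^ (d + 1) + 2) ^ d * L ^ d) * (2 : ℝ) ^ ((2 ^ (d + 1) + 2) ^ d * L ^ d)) ^
          (blocks (L * L ^ k) U).card *
        A ^ (-((1 + 1 / ((2 * (2 ^ d + 1) + 6 : ℝ) ^ d)) * (blocks (L * L ^ k) U).card) : ℝ)) := by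
  obtain ⟨hMeq, htodd, hgain⟩ := gain_pow (d := d) hLodd hL2 hL4 hM hkN
  obtain ⟨-, hη2⟩ := eta_bounds d
  refine (sum_reblock_large_le hMeq hLodd.pow hLodd htodd hA hη2 hc hE hgain h𝓧'' hconn htwo hF).trans
    (le_of_eq ?_)
  rw [card_blocks_eq_mul hMeq hLodd.pow hLodd htodd hU, ← mul_assoc ((2 ^ (d + 1) + 2) ^ d), pow_mul, pow_mul,
    mul_pow]
  ring

end Literature.MathematicalPhysics.StatisticalMechanics.TorusPolymer

end
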